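import Literature.Computability.MetaComplexity.OrderParitySystems
import HarnessLib

/-!
# Parity constraints on linear orders, II: the extension lemma (Gryaznov 2019, Lemma 3.4; GOR 2024, Lemma 3)

The induction of [Gryaznov–Ovcharov–Riazanov 2024, Lemma 3] assembled from the pieces of
`OrderParitySystems.lean`:

* `OrderParity.exists_ranking_lt_of_ascending` — for systems oriented upwards w.r.t. the given
  ranking `r` (every occurring pair `(k, l)` has `r k < r l`), by induction on `|S|`: no pair /
  star at the minimum / glue `j` into `i` and lift;
* `OrderParity.exists_ranking_lt` — the printed statement in ranking language: `|S| ≥ 2`, at most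
  `|S| - 2` forms on off-diagonal pairs of `S`, any ranking `r`, any `i ∈ S` ⇒ a ranking with the
  same parities on every form in which `i` is not the minimum.

## References

* S. Gryaznov, *Notes on resolution over linear equations*, CSR 2019, LNCS 11532, Lemma 3.4
  [Gryaznov2019].
* S. Gryaznov, S. Ovcharov, A. Riazanov, ACM Trans. Comput. Theory 16(3) (2024) =
  arXiv:2404.08370, §3.1.2, Lemma 3 [GryaznovOvcharovRiazanov2024].
-/

namespace Literature.Computability.MetaComplexity

namespace OrderParity

open Finset

/-- Make the pair `q` occur in no form: add `T₀ ∋ q` to every form containing `q`.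
[Gryaznov–Ovcharov–Riazanov 2024, Lemma 3 (proof: "Consider any equation of `Ax = b` with `x_{ij}`
and add it to the other ones that also contain `x_{ij}`")] [cite: GryaznovOvcharovRiazanov2024, Lemma 3] -/
def eliminate (T₀ : Finset (ℕ × ℕ)) (q : ℕ × ℕ) (T : Finset (ℕ × ℕ)) : Finset (ℕ × ℕ) :=
  if q ∈ T then symmDiff T T₀ else T

/-- After elimination `q` occurs nowhere (given `q ∈ T₀`). [folklore] -/
theorem not_mem_eliminate {T₀ : Finset (ℕ × ℕ)} {q : ℕ × ℕ} (hq : q ∈ T₀) (T : Finset (ℕ × ℕ)) :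
    q ∉ eliminate T₀ q T := by
  unfold eliminate
  split_ifs with h
  · rw [Finset.mem_symmDiff]; push Not; exact ⟨fun _ => hq, fun _ => h⟩
  · exact h

/-- The pairs of an eliminated form come from the form or from `T₀`. [folklore] -/
theorem mem_or_mem_of_mem_eliminate {T₀ T : Finset (ℕ × ℕ)} {q p : ℕ × ℕ}
    (hp : p ∈ eliminate T₀ q T) : p ∈ T ∨ p ∈ T₀ := by
  unfold eliminate at hp
  split_ifs at hp with h
  · rw [Finset.mem_symmDiff] at hp
    rcases hp with ⟨h1, -⟩ | ⟨h2, -⟩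
    · exact Or.inl h1
    · exact Or.inr h2
  · exact Or.inl hp

/-- Row operations are invertible: equal parities on the eliminated form and on `T₀` give equal
parities on the original form. [Gryaznov–Ovcharov–Riazanov 2024, Lemma 3 (proof: the new system
"is clearly equivalent to `Ax = b`")] [cite: GryaznovOvcharovRiazanov2024, Lemma 3] -/
theorem pairParity_eq_of_eliminate {r r' : ℕ → ℕ} {T₀ T : Finset (ℕ × ℕ)} {q : ℕ × ℕ}
    (hT : pairParity r' (eliminate T₀ q T) = pairParity r (eliminate T₀ q T))
    (h₀ : pairParity r' T₀ = pairParity r T₀) : pairParity r' T = pairParity r T := by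
  unfold eliminate at hT
  split_ifs at hT with h
  · rw [pairParity_symmDiff, pairParity_symmDiff, h₀] at hT
    exact add_right_cancel hT
  · exact hT

/-- **Lemma 3, oriented form** [Gryaznov–Ovcharov–Riazanov 2024, Lemma 3; Gryaznov 2019, Lemma 3.4]:
for a ground set `S` with `|S| = N`, a ranking `r` injective on `S` with minimum `m`, and a list `Φ`
of at most `N - 2` forms all of whose pairs are ascending pairs of `S`, there is a ranking `r'`
injective on `S` with the same parity as `r` on every form of `Φ` and whose minimum is not `m`.
Proof as printed, by induction on `N` (no pair / star at `m` / glue and lift).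
[cite: GryaznovOvcharovRiazanov2024, Lemma 3] -/
theorem exists_ranking_lt_of_ascending (N : ℕ) :
    ∀ (S : Finset ℕ) (r : ℕ → ℕ) (m : ℕ) (Φ : List (Finset (ℕ × ℕ))),
      S.card = N → Set.InjOn r S → m ∈ S → (∀ x ∈ S, r m ≤ r x) → Φ.length + 2 ≤ N →
      (∀ T ∈ Φ, ∀ p ∈ T, p.1 ∈ S ∧ p.2 ∈ S ∧ r p.1 < r p.2) →
      ∃ r' : ℕ → ℕ, Set.InjOn r' S ∧ (∀ T ∈ Φ, pairParity r' T = pairParity r T) ∧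
        ∃ x ∈ S, r' x < r' m := by
  induction N with
  | zero => intro S r m Φ _ _ _ _ hlen _; omega
  | succ N ih =>
    intro S r m Φ hcard hr hm hmin hlen hΦ
    classical
    -- ### Case 0: no pair occurs
    by_cases h0 : ∀ T ∈ Φ, T = ∅
    · exact exists_ranking_lt_of_forall_eq_empty hr (by omega) h0
    -- ### the occurring pairs not starting at `m`
    set A : Finset (ℕ × ℕ) := (Φ.toFinset.biUnion id).filter fun p => p.1 ≠ m with hA_def
    have hA : ∀ p, p ∈ A ↔ (∃ T ∈ Φ, p ∈ T) ∧ p.1 ≠ m := by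
      intro p
      rw [hA_def, Finset.mem_filter, Finset.mem_biUnion]
      simp only [List.mem_toFinset, id]
    by_cases hstar : A = ∅
    · -- ### Case A: every occurring pair starts at `m`
      refine exists_ranking_lt_of_star hr hm (by omega) fun T hT p hp => ?_
      obtain ⟨h1, h2, hlt⟩ := hΦ T hT p hp
      have hp1 : p.1 = m := by
        by_contra hne
        have : p ∈ A := (hA p).2 ⟨⟨T, hT, hp⟩, hne⟩
        rw [hstar] at this
        exact Finset.notMem_empty p this
      refine ⟨hp1, h2, ?_⟩
      rw [← hp1]; exact hlt
    -- ### Case B: an occurring pair `(i, j)`, `i ≠ m`, of minimal length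
    obtain ⟨⟨i, j⟩, hijA, hijmin⟩ :=
      Finset.exists_min_image A (fun p => r p.2 - r p.1) (Finset.nonempty_of_ne_empty hstar)
    obtain ⟨⟨T₀, hT₀Φ, hijT₀⟩, him⟩ := (hA (i, j)).1 hijA
    simp only at him
    obtain ⟨hiS, hjS, hrij⟩ := hΦ T₀ hT₀Φ (i, j) hijT₀
    simp only at hiS hjS hrij
    have hij : i ≠ j := fun h => by rw [h] at hrij; exact lt_irrefl _ hrij
    have hmi : r m < r i := lt_of_le_of_ne (hmin i hiS) fun h => him (hr hiS hm h.symm)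
    have hmj : m ≠ j := fun h => by rw [← h] at hrij; omega
    -- no other occurring pair lies inside the interval `[i, j]`
    have hfree : ∀ T ∈ Φ, ∀ p ∈ T, p ≠ (i, j) → ¬ (r i ≤ r p.1 ∧ r p.2 ≤ r j) := by
      intro T hT p hp hpij ⟨hi1, h2j⟩
      obtain ⟨h1, h2, hlt⟩ := hΦ T hT p hp
      by_cases hp1 : p.1 = m
      · rw [hp1] at hi1; omega
      · have hle := hijmin p ((hA p).2 ⟨⟨T, hT, hp⟩, hp1⟩)
        simp only at hle
        have he1 : r p.1 = r i := by omega
        have he2 : r p.2 = r j := by omega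
        exact hpij (Prod.ext (hr h1 hiS he1) (hr h2 hjS he2))
    -- ### elimination: `(i, j)` occurs in `T₀` only
    set B : List (Finset (ℕ × ℕ)) := (Φ.erase T₀).map (eliminate T₀ (i, j)) with hB_def
    have hBmem : ∀ T ∈ B, ∀ p ∈ T, ∃ T' ∈ Φ, p ∈ T' := by
      intro T hT p hp
      rw [hB_def, List.mem_map] at hT
      obtain ⟨T₁, hT₁, rfl⟩ := hT
      rcases mem_or_mem_of_mem_eliminate hp with h | h
      · exact ⟨T₁, List.mem_of_mem_erase hT₁, h⟩
      · exact ⟨T₀, hT₀Φ, h⟩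
    have hBij : ∀ T ∈ B, (i, j) ∉ T := by
      intro T hT
      rw [hB_def, List.mem_map] at hT
      obtain ⟨T₁, -, rfl⟩ := hT
      exact not_mem_eliminate hijT₀ T₁
    have hBlen : B.length + 1 = Φ.length := by
      rw [hB_def, List.length_map, List.length_erase_of_mem hT₀Φ]
      have : 0 < Φ.length := List.length_pos_of_mem hT₀Φ
      omega
    have hBrec : ∀ r' : ℕ → ℕ, (∀ T ∈ B, pairParity r' T = pairParity r T) →
        pairParity r' T₀ = pairParity r T₀ → ∀ T ∈ Φ, pairParity r' T = pairParity r T := by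
      intro r' hB h₀ T hT
      by_cases hTT₀ : T = T₀
      · rw [hTT₀]; exact h₀
      · have hTB : eliminate T₀ (i, j) T ∈ B := by
          rw [hB_def, List.mem_map]
          exact ⟨T, (List.mem_erase_of_ne hTT₀).2 hT, rfl⟩
        exact pairParity_eq_of_eliminate (hB _ hTB) h₀
    -- facts about the pairs of `B`: ascending pairs of `S`, not `(i, j)`, `(j, i)`, off the interval
    have hBpair : ∀ T ∈ B, ∀ p ∈ T, p.1 ∈ S ∧ p.2 ∈ S ∧ r p.1 < r p.2 ∧ p ≠ (i, j) ∧ p ≠ (j, i) ∧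
        ¬ (r i ≤ r p.1 ∧ r p.2 ≤ r j) := by
      intro T hT p hp
      obtain ⟨T', hT', hp'⟩ := hBmem T hT p hp
      obtain ⟨h1, h2, hlt⟩ := hΦ T' hT' p hp'
      have hpij : p ≠ (i, j) := fun h => hBij T hT (h ▸ hp)
      have hpji : p ≠ (j, i) := fun h => by rw [h] at hlt; simp only at hlt; omega
      exact ⟨h1, h2, hlt, hpij, hpji, hfree T' hT' p hp' hpij⟩
    -- ### gluing: the system `B'` on `S ∖ {j}`
    set G := gluePair i j with hG
    set B' : List (Finset (ℕ × ℕ)) := B.map (parityImage G) with hB'_def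
    -- glued pairs are ascending pairs of `S ∖ {j}`
    have hGasc : ∀ T ∈ B, ∀ p ∈ T,
        (G p).1 ∈ S.erase j ∧ (G p).2 ∈ S.erase j ∧ r (G p).1 < r (G p).2 := by
      intro T hT p hp
      obtain ⟨h1, h2, hlt, hpij, -, hfr⟩ := hBpair T hT p hp
      refine ⟨glue_mem_erase hiS hij h1, glue_mem_erase hiS hij h2, ?_⟩
      simp only [hG, gluePair, glue]
      by_cases hp1 : p.1 = j <;> by_cases hp2 : p.2 = j
      · rw [hp1, hp2] at hlt; exact absurd hlt (lt_irrefl _)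
      · rw [if_pos hp1, if_neg hp2]; rw [hp1] at hlt; omega
      · rw [if_neg hp1, if_pos hp2]
        have hki : p.1 ≠ i := fun h => hpij (Prod.ext h hp2)
        rw [hp2] at hfr
        by_contra hge
        exact hfr ⟨not_lt.1 hge, le_rfl⟩
      · rw [if_neg hp1, if_neg hp2]; exact hlt
    have hB'asc : ∀ T' ∈ B', ∀ q ∈ T', q.1 ∈ S.erase j ∧ q.2 ∈ S.erase j ∧ r q.1 < r q.2 := by
      intro T' hT' q hq
      rw [hB'_def, List.mem_map] at hT'
      obtain ⟨T, hT, rfl⟩ := hT'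
      obtain ⟨p, hp, rfl⟩ := exists_of_mem_parityImage hq
      exact hGasc T hT p hp
    -- gluing keeps the parities under `r` (all bits are `1` before and after)
    have hB'par : ∀ T ∈ B, pairParity r (parityImage G T) = pairParity r T := by
      intro T hT
      unfold pairParity
      rw [sum_parityImage]
      refine Finset.sum_congr rfl fun p hp => ?_
      obtain ⟨-, -, hlt'⟩ := hGasc T hT p hp
      obtain ⟨-, -, hlt, -⟩ := hBpair T hT p hp
      unfold cmpBit; rw [if_pos hlt', if_pos hlt]
    -- ### induction hypothesis on `S ∖ {j}`
    have hcard' : (S.erase j).card = N := by rw [Finset.card_erase_of_mem hjS, hcard]; rfl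
    have hlen' : B'.length + 2 ≤ N := by rw [hB'_def, List.length_map]; omega
    obtain ⟨r₁, hr₁, hr₁par, x₁, hx₁, hx₁m⟩ := ih (S.erase j) r m B' hcard'
      (hr.mono (Finset.coe_subset.2 (Finset.erase_subset j S)))
      (Finset.mem_erase.2 ⟨hmj, hm⟩) (fun x hx => hmin x (Finset.mem_of_mem_erase hx)) hlen' hB'asc
    obtain ⟨hx₁j, hx₁S⟩ := Finset.mem_erase.1 hx₁
    -- ### the two lifts solve `B`
    obtain ⟨hinjA, hinjB⟩ := injOn_lifts (i := i) hr₁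
    have hliftB : ∀ T ∈ B, pairParity (liftAfter r₁ i j) T = pairParity r T ∧
        pairParity (liftBefore r₁ i j) T = pairParity r T := by
      intro T hT
      have hT' : parityImage G T ∈ B' := by rw [hB'_def, List.mem_map]; exact ⟨T, hT, rfl⟩
      have key := (hr₁par _ hT').trans (hB'par T hT)
      unfold pairParity at key ⊢
      rw [sum_parityImage] at key
      constructor
      · rw [← key]
        refine Finset.sum_congr rfl fun p hp => ?_
        obtain ⟨h1, h2, hlt, hpij, hpji, -⟩ := hBpair T hT p hp
        exact (cmpBit_lifts hr₁ hiS hij h1 h2 (fun h => by rw [h] at hlt; omega) hpij hpji).1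
      · rw [← key]
        refine Finset.sum_congr rfl fun p hp => ?_
        obtain ⟨h1, h2, hlt, hpij, hpji, -⟩ := hBpair T hT p hp
        exact (cmpBit_lifts hr₁ hiS hij h1 h2 (fun h => by rw [h] at hlt; omega) hpij hpji).2
    -- ### on `T₀` the two lifts differ exactly in the bit of `(i, j)`
    set c : ZMod 2 := ∑ p ∈ T₀.erase (i, j), cmpBit r₁ (G p) with hc
    have hrest : ∀ p ∈ T₀.erase (i, j), cmpBit (liftAfter r₁ i j) p = cmpBit r₁ (G p) ∧
        cmpBit (liftBefore r₁ i j) p = cmpBit r₁ (G p) := by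
      intro p hp
      obtain ⟨hpij, hpT₀⟩ := Finset.mem_erase.1 hp
      obtain ⟨h1, h2, hlt⟩ := hΦ T₀ hT₀Φ p hpT₀
      have hpji : p ≠ (j, i) := fun h => by rw [h] at hlt; simp only at hlt; omega
      exact cmpBit_lifts hr₁ hiS hij h1 h2 (fun h => by rw [h] at hlt; omega) hpij hpji
    have hA₀ : pairParity (liftAfter r₁ i j) T₀ = 1 + c := by
      unfold pairParity
      rw [← Finset.add_sum_erase T₀ _ hijT₀, (cmpBit_lifts_self r₁ hij).1, hc]
      congr 1
      exact Finset.sum_congr rfl fun p hp => (hrest p hp).1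
    have hB₀ : pairParity (liftBefore r₁ i j) T₀ = c := by
      unfold pairParity
      rw [← Finset.add_sum_erase T₀ _ hijT₀, (cmpBit_lifts_self r₁ hij).2, hc, zero_add]
      exact Finset.sum_congr rfl fun p hp => (hrest p hp).2
    -- ### choose the lift that solves `T₀`
    by_cases h₀ : pairParity r T₀ = c
    · refine ⟨liftBefore r₁ i j, hinjB, hBrec _ (fun T hT => (hliftB T hT).2) (hB₀.trans h₀.symm),
        x₁, hx₁S, ?_⟩
      unfold liftBefore; rw [if_neg hx₁j, if_neg hmj]; omega
    · have h₁ : pairParity r T₀ = c + 1 := zmod2_eq_add_one_of_ne h₀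
      refine ⟨liftAfter r₁ i j, hinjA, hBrec _ (fun T hT => (hliftB T hT).1)
        (by rw [hA₀, h₁, add_comm]), x₁, hx₁S, ?_⟩
      unfold liftAfter; rw [if_neg hx₁j, if_neg hmj]; omega

/-- **Lemma 3 in ranking language** [Gryaznov–Ovcharov–Riazanov 2024, Lemma 3; Gryaznov 2019,
Lemma 3.4 ("Let `Ax = b` be the linear system in the variables of `Ordering_n` with at most `n - 2`
equations that has an `E`-respectful solution. Then for every clause `C ∈ F` there is the
`E`-respectful solution `τ` of the system `Ax = b` that satisfies `C`")]: for `|S| ≥ 2`, at most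
`|S| - 2` forms on off-diagonal pairs of `S`, every ranking `r` injective on `S` and every `i ∈ S`,
some ranking injective on `S` gives every form the same parity as `r` and does not have `i` as its
minimum. [cite: GryaznovOvcharovRiazanov2024, Lemma 3] -/
theorem exists_ranking_lt {S : Finset ℕ} {r : ℕ → ℕ} (hr : Set.InjOn r S) {i : ℕ} (hi : i ∈ S)
    {Φ : List (Finset (ℕ × ℕ))} (hlen : Φ.length + 2 ≤ S.card)
    (hΦ : ∀ T ∈ Φ, ∀ p ∈ T, p.1 ∈ S ∧ p.2 ∈ S ∧ p.1 ≠ p.2) :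
    ∃ r' : ℕ → ℕ, Set.InjOn r' S ∧ (∀ T ∈ Φ, pairParity r' T = pairParity r T) ∧
      ∃ x ∈ S, r' x < r' i := by
  classical
  by_cases hlt : ∃ x ∈ S, r x < r i
  · exact ⟨r, hr, fun _ _ => rfl, hlt⟩
  push Not at hlt
  -- orient all pairs upwards and apply the oriented lemma
  set Ψ : List (Finset (ℕ × ℕ)) := Φ.map (parityImage (orient r)) with hΨ
  have hΨlen : Ψ.length + 2 ≤ S.card := by rw [hΨ, List.length_map]; exact hlen
  have hΨasc : ∀ T' ∈ Ψ, ∀ q ∈ T', q.1 ∈ S ∧ q.2 ∈ S ∧ r q.1 < r q.2 := by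
    intro T' hT' q hq
    rw [hΨ, List.mem_map] at hT'
    obtain ⟨T, hT, rfl⟩ := hT'
    exact ascending_of_mem_parityImage_orient hr (hΦ T hT) hq
  obtain ⟨r', hr', hpar, hx⟩ :=
    exists_ranking_lt_of_ascending S.card S r i Ψ rfl hr hi hlt hΨlen hΨasc
  refine ⟨r', hr', fun T hT => ?_, hx⟩
  have hT' : parityImage (orient r) T ∈ Ψ := by rw [hΨ, List.mem_map]; exact ⟨T, hT, rfl⟩
  have key := hpar _ hT'
  rw [pairParity_parityImage_orient hr' (hΦ T hT), pairParity_parityImage_orient hr (hΦ T hT)] at key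
  exact add_right_cancel key

end OrderParity

end Literature.Computability.MetaComplexity
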